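import Mathlib

/-!
# PP(12), family B1-p: fixed-point congruences for a collineation of prime order (Lemma 2/4 arithmetic, kernel)
Framing: lottery ticket; floor = certified bounds/negative ranges.

First bricks of the NECESSITY direction of FAMILY-B1P.md (cell pub-namedobj, target M), in Mathlib's
vocabulary (`Configuration.ProjectivePlane`): a *collineation* is a pair of bijections of points and lines
preserving incidence. For a collineation `σ` with `σ ^ q = 1` on points, `q` prime:

* `fixedCard_modEq` — on any finite set, a permutation `τ` with `τ ^ q = 1` has
  `#{fixed points} ≡ #set (mod q)` (from Mathlib's cycle-type count);
* `fixedOnLine_modEq` — on a FIXED line `l` the number of fixed points is `≡ order + 1 (mod q)`;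
* `card_fixedPoints_modEq_card` — the total number of fixed points is `≡ order² + order + 1 (mod q)`;
* for order `12`: on a fixed line a collineation with `σ¹¹ = 1` fixes `2` or all `13` points
  (`fixedOnLine_order12_q11`), with `σ⁷ = 1` it fixes `6` or `13` (`…_q7`), with `σ¹³ = 1` it fixes `0` or
  `13` (`…_q13`); and the total fixed-point count is `≡ 3 (mod 11)`, `≡ 3 (mod 7)`, `≡ 1 (mod 13)`.

These are exactly the congruences that split `p = 11` into the homology case (a fixed line carrying 13 fixed
points) and the triangle case (every fixed line carries exactly 2) in FAMILY-B1P Lemma 4, and that start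
Lemma 3 (`p = 7`) and the antiflag structure for `p = 13`. The remaining steps (axis ⇒ central collineation;
Bruck's subplane bound) are NOT formalised here.
-/

namespace Summit.Ventures.DiscreteObjects.PP12

open Configuration Finset

section Perm

variable {α : Type*} [Fintype α] [DecidableEq α]

/-- number of fixed points of a permutation of a finite type -/
def fixedCard (τ : Equiv.Perm α) : ℕ := (univ.filter fun x => τ x = x).card

/-- The fixed points are the complement of the support. -/
theorem fixedCard_eq_card_compl_support (τ : Equiv.Perm α) : fixedCard τ = τ.supportᶜ.card := by
  unfold fixedCard
  congr 1
  ext x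
  simp [Equiv.Perm.mem_support]

/-- A permutation `τ` of a finite set with `τ ^ q = 1`, `q` prime, has `#fixed points ≡ #set (mod q)`. -/
theorem fixedCard_modEq {q : ℕ} [hq : Fact q.Prime] {τ : Equiv.Perm α} (hτ : τ ^ q = 1) :
    fixedCard τ ≡ Fintype.card α [MOD q] := by
  rw [fixedCard_eq_card_compl_support]
  exact Equiv.Perm.card_compl_support_modEq (n := 1) (by simpa using hτ)

end Perm

/-- A collineation of an incidence structure, concretely: a bijection of the points and a bijection of the
lines that together preserve incidence. -/
structure Collineation (P L : Type*) [Membership P L] where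
  /-- action on points -/
  onPoints : Equiv.Perm P
  /-- action on lines -/
  onLines : Equiv.Perm L
  /-- incidence is preserved -/
  mem_iff : ∀ (p : P) (l : L), onPoints p ∈ onLines l ↔ p ∈ l

namespace Collineation

variable {P L : Type*} [Membership P L] (σ : Collineation P L)

/-- A fixed line is mapped into itself pointwise-as-a-set: `σ p ∈ l ↔ p ∈ l`. -/
theorem mem_fixedLine_iff {l : L} (hl : σ.onLines l = l) (p : P) : σ.onPoints p ∈ l ↔ p ∈ l := by
  simpa [hl] using σ.mem_iff p l

/-- The permutation induced on the points of a fixed line. -/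
def restrict {l : L} (hl : σ.onLines l = l) : Equiv.Perm {p : P // p ∈ l} :=
  σ.onPoints.subtypePerm (σ.mem_fixedLine_iff hl)

/-- `(σ|l) ^ q = 1` when `σ ^ q = 1` on points. -/
theorem restrict_pow_eq_one {l : L} (hl : σ.onLines l = l) {q : ℕ} (hq : σ.onPoints ^ q = 1) :
    σ.restrict hl ^ q = 1 := by
  unfold restrict
  rw [Equiv.Perm.subtypePerm_pow]
  simp [hq]

variable [Fintype P] [DecidableEq P]

/-- number of fixed points of `σ` on the line `l` -/
def fixedOnLine (l : L) [DecidablePred (· ∈ l)] : ℕ := (univ.filter fun p => p ∈ l ∧ σ.onPoints p = p).card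

/-- The fixed points of `σ` on a fixed line `l` are the fixed points of the induced permutation `σ|l`. -/
theorem fixedOnLine_eq_fixedCard_restrict {l : L} [DecidablePred (· ∈ l)] (hl : σ.onLines l = l) :
    σ.fixedOnLine l = fixedCard (σ.restrict hl) := by
  unfold fixedOnLine fixedCard
  rw [← Fintype.card_subtype, ← Fintype.card_subtype]
  refine Fintype.card_congr ?_
  refine (Equiv.subtypeSubtypeEquivSubtypeInter (fun p : P => p ∈ l) (fun p => σ.onPoints p = p)).symm.trans ?_
  refine Equiv.subtypeEquivRight fun x => ?_
  simp [restrict, Equiv.Perm.subtypePerm_apply, Subtype.ext_iff]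

/-- **Fixed line congruence.** In a finite projective plane, a collineation with `σ ^ q = 1` on points
(`q` prime) fixes, on any line it fixes, a number of points `≡ order + 1 (mod q)`. -/
theorem fixedOnLine_modEq [Fintype L] [ProjectivePlane P L] {l : L} [DecidablePred (· ∈ l)]
    (hl : σ.onLines l = l) {q : ℕ} [Fact q.Prime] (hq : σ.onPoints ^ q = 1) :
    σ.fixedOnLine l ≡ ProjectivePlane.order P L + 1 [MOD q] := by
  rw [σ.fixedOnLine_eq_fixedCard_restrict hl, ← ProjectivePlane.pointCount_eq P l, pointCount,
    Nat.card_eq_fintype_card]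
  exact fixedCard_modEq (σ.restrict_pow_eq_one hl hq)

/-- **Global congruence.** The number of fixed points of such a collineation is
`≡ order² + order + 1 (mod q)`. -/
theorem card_fixedPoints_modEq_card [Fintype L] [ProjectivePlane P L] {q : ℕ} [Fact q.Prime]
    (hq : σ.onPoints ^ q = 1) :
    fixedCard σ.onPoints ≡ ProjectivePlane.order P L ^ 2 + ProjectivePlane.order P L + 1 [MOD q] := by
  rw [← ProjectivePlane.card_points P L]
  exact fixedCard_modEq hq

/-- the number of fixed points on a line is at most the number of points on it -/
theorem fixedOnLine_le [Fintype L] [ProjectivePlane P L] (l : L) [DecidablePred (· ∈ l)] :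
    σ.fixedOnLine l ≤ ProjectivePlane.order P L + 1 := by
  rw [← ProjectivePlane.pointCount_eq P l, pointCount, Nat.card_eq_fintype_card, Fintype.card_subtype]
  exact Finset.card_le_card (fun p hp => by simp only [mem_filter, mem_univ, true_and] at hp ⊢; exact hp.1)

section OrderTwelve

variable [Fintype L] [ProjectivePlane P L] (h12 : ProjectivePlane.order P L = 12)
include h12

/-- Order 12, `σ¹¹ = 1`: a fixed line carries exactly `2` or all `13` fixed points (FAMILY-B1P Lemma 4:
`13` = axis/homology case A, `2` on every fixed line = triangle case B). -/
theorem fixedOnLine_order12_q11 {l : L} [DecidablePred (· ∈ l)] (hl : σ.onLines l = l)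
    (hq : σ.onPoints ^ 11 = 1) : σ.fixedOnLine l = 2 ∨ σ.fixedOnLine l = 13 := by
  haveI : Fact (Nat.Prime 11) := ⟨by norm_num⟩
  have h1 := σ.fixedOnLine_modEq hl hq
  have h2 := σ.fixedOnLine_le l
  rw [h12] at h1 h2
  unfold Nat.ModEq at h1
  omega

/-- Order 12, `σ⁷ = 1`: a fixed line carries exactly `6` or all `13` fixed points (start of Lemma 3). -/
theorem fixedOnLine_order12_q7 {l : L} [DecidablePred (· ∈ l)] (hl : σ.onLines l = l)
    (hq : σ.onPoints ^ 7 = 1) : σ.fixedOnLine l = 6 ∨ σ.fixedOnLine l = 13 := by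
  haveI : Fact (Nat.Prime 7) := ⟨by norm_num⟩
  have h1 := σ.fixedOnLine_modEq hl hq
  have h2 := σ.fixedOnLine_le l
  rw [h12] at h1 h2
  unfold Nat.ModEq at h1
  omega

/-- Order 12, `σ¹³ = 1`: a fixed line carries no fixed point or all `13` (antiflag structure for `p = 13`). -/
theorem fixedOnLine_order12_q13 {l : L} [DecidablePred (· ∈ l)] (hl : σ.onLines l = l)
    (hq : σ.onPoints ^ 13 = 1) : σ.fixedOnLine l = 0 ∨ σ.fixedOnLine l = 13 := by
  haveI : Fact (Nat.Prime 13) := ⟨by norm_num⟩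
  have h1 := σ.fixedOnLine_modEq hl hq
  have h2 := σ.fixedOnLine_le l
  rw [h12] at h1 h2
  unfold Nat.ModEq at h1
  omega

/-- Order 12, `σ⁵ = 1`: a fixed line carries `3`, `8` or `13` fixed points (JvT's `p = 5` casework starts here). -/
theorem fixedOnLine_order12_q5 {l : L} [DecidablePred (· ∈ l)] (hl : σ.onLines l = l)
    (hq : σ.onPoints ^ 5 = 1) : σ.fixedOnLine l = 3 ∨ σ.fixedOnLine l = 8 ∨ σ.fixedOnLine l = 13 := by
  haveI : Fact (Nat.Prime 5) := ⟨by norm_num⟩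
  have h1 := σ.fixedOnLine_modEq hl hq
  have h2 := σ.fixedOnLine_le l
  rw [h12] at h1 h2
  unfold Nat.ModEq at h1
  omega

/-- Order 12: total fixed-point counts are `≡ 3 (mod 11)`, `≡ 3 (mod 7)`, `≡ 1 (mod 13)` respectively. -/
theorem fixedCard_order12 :
    (σ.onPoints ^ 11 = 1 → fixedCard σ.onPoints % 11 = 3) ∧
    (σ.onPoints ^ 7 = 1 → fixedCard σ.onPoints % 7 = 3) ∧
    (σ.onPoints ^ 13 = 1 → fixedCard σ.onPoints % 13 = 1) := by
  haveI : Fact (Nat.Prime 11) := ⟨by norm_num⟩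
  haveI : Fact (Nat.Prime 7) := ⟨by norm_num⟩
  haveI : Fact (Nat.Prime 13) := ⟨by norm_num⟩
  refine ⟨fun hq => ?_, fun hq => ?_, fun hq => ?_⟩ <;>
  · have h1 := σ.card_fixedPoints_modEq_card hq
    rw [h12] at h1
    unfold Nat.ModEq at h1
    omega

end OrderTwelve

end Collineation

end Summit.Ventures.DiscreteObjects.PP12
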